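import Summits.MatrixMultiplication.OmegaCensus.ThreeSetZ5Z5Cover6Defs
import HarnessLib

/-!
# Three-set `ℤ₅ × ℤ₅` cover, parts `3` and `6`: hole positions `σ ∈ {9, 15}`

ω-census `pub-omega`, family (b3), seat pub-omega-group gen 36.  Framing: lottery ticket; floor = certified bounds/negative
ranges.  VALUE: finite kernel computations behind `ThreeSetZ5Z5Cells36.lean` (no cube symmetric form with `|W| = 3`, `|X| = 6`
over any odd-order `A ↠ ℤ₅ × ℤ₅`); NOT progress on ω.

For each hole position `σ` (point `pt 5 σ`): `sound6_σ : soundChk3 5 6 (tree6 σ) (cert6 σ) = true` (every unflagged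
(direction, count vector) is certified at the hole value of that direction) and `cover6_σ : cover3C 5 6 (tree6 σ) = true`
(the two-margin enumeration of `ThreeSetZ5Z5CoverKitC.lean`: every multiset of size `6` on `ℤ₅²` has an unflagged direction),
both `decide +kernel`; Python twin with identical leaf/node counts: `pub-omega-group-g36/code/emulate3c.py`.
Assembled over all `σ < 25` in `ThreeSetZ5Z5Cover6.lean`.
-/

namespace Summit.MatrixMultiplication.OmegaCensus

namespace Z5Z5ThreeSet

open ZpZpDomino

/-- Soundness check, hole position `σ = 9` (`s = (1,4)`). [folklore] -/
theorem sound6_9 : soundChk3 5 6 (tree6 9) (cert6 9) = true := by decide +kernel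

/-- Cover computation  hole position `σ = 9` (4 720 leaves, 15 449 nodes). [folklore] -/
theorem cover6_9 : cover3C 5 6 (tree6 9) = true := by decide +kernel

/-- Soundness check, hole position `σ = 15` (`s = (3,0)`). [folklore] -/
theorem sound6_15 : soundChk3 5 6 (tree6 15) (cert6 15) = true := by decide +kernel

/-- Cover computation  hole position `σ = 15` (4 544 leaves, 15 922 nodes). [folklore] -/
theorem cover6_15 : cover3C 5 6 (tree6 15) = true := by decide +kernel

end Z5Z5ThreeSet

end Summit.MatrixMultiplication.OmegaCensus
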